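import Summits.HodgeConjecture.HodgeConjecture.Theorems.HeckePrymWeilHeckePrymAnchorsSurfaceProductStep
import Literature.AlgebraicGeometry.HodgeTheory.WeilClassesHodgeType
import Literature.AlgebraicGeometry.HodgeTheory.HodgeTypeExteriorProduct
import Literature.AlgebraicGeometry.HodgeTheory.HodgeTypeConjugation
import Literature.NumberTheory.Transcendental.DeRhamTheoremMultiplicative
import Literature.AlgebraicGeometry.Motives.AbelianVarietyCohomologyExteriorH1
import HarnessLib

/-!
# Crux `HeckePrymAnchors` (stmt-HodgeConjecture-14496), line `Sketch` v17 · stub `stub_unbalancedZero`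

Route `HeckePrymWeil`, continuation lead c11. Deligne–Milne, LNM 900, Prop. 4.4 on a product: let
`(A, φ)` be a complex abelian `2n`-fold with `φ ≫ φ = -p` (`p, n ≥ 1`) which is NOT of balanced
Weil type — the multiplicity `a := dim (V₊ ∩ H^{1,0}(A))` of the eigenvalue `i√p` of `φ^*` on
`H^{1,0}` differs from `n` — and let `(B, ψ)`, `ψ ≫ ψ = -p`, be a Weil SURFACE carrying a non-zero
`(1,1)` class in its strong Weil plane (hence balanced). Then the strong Weil plane
`weilClassesOf (A × B) (φ × ψ) (n + 1) p ⊆ H^{2n+2}((A × B)(ℂ); ℂ)` contains NO non-zero class of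
Hodge type `(n+1, n+1)`.

## Proof (van Geemen LNM 1594, 4.9–4.10 and proof of Thm. 6.12)

Write `E±(X)` for the two Weil lines (`weilClassesPlus/Minus`), so that `weilClassesOf = E₊ ⊔ E₋`.

* Each `E±(X)` (`X = A, B, A × B`) is a LINE spanned by any non-zero member
  (`finrank_weilClassesPlus/Minus_eq_one`, `weilClassesPlus/Minus_le_span_singleton`, fed with
  `H• = ⋀• H¹`, `Motives.AbelianVariety.hasExteriorCohomologyH1_complexPoints`, and `b₁ = 2 dim`,
  `Motives.AbelianVariety.finrank_complexBetti_one`).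
* `E₊(A)` is of Hodge type `(a, a')`, `E₋(A)` of type `(a', a)`, `a + a' = 2n`
  (`isOfHodgeType_of_mem_weilClassesPlus/Minus`, `finrank_inf_hodgeOneZero_add_finrank_inf_hodgeZeroOne`);
  `B` is balanced (`finrank_eq_of_mem_weilClassesOf`), so `E±(B)` are of type `(1, 1)`.
* The exterior product `x± := pr_A^* a± ∪ pr_B^* b±` of non-zero `a± ∈ E±(A)`, `b± ∈ E±(B)` is a
  NON-ZERO (`sps_cupProduct_map_fst_map_snd_ne_zero_prod`, Künneth) member of `E±(A × B)`
  (`cupProduct_map_fst_map_snd_mem_weilClassesPlus/Minus`) of type `(a+1, a'+1)`, resp.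
  `(a'+1, a+1)` (types add under exterior products,
  `isOfHodgeType_cupProduct_map_fst_map_snd_of_multiplicative_deRham` fed with de Rham's theorem
  `exists_deRhamIsoFamily_holds`); hence `E±(A × B) = ℂ · x±` have those types.
* A class `c = c₊ + c₋` of the plane of type `(n+1, n+1)` with `a ≠ n` (so `(n+1, n+1)` differs
  from both `(a+1, a'+1)` and `(a'+1, a+1)`, as `a + a' = 2n`) vanishes by the independence of the
  Hodge pieces (`IsOfHodgeType.add_eq_zero_of_ne`).

No definition, no named fact, no `sorry`.
-/

noncomputable section

-- every declaration of this problem lives in `Summit.HodgeConjecture.HodgeConjecture.…` (summit = sub-problem)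
set_option linter.dupNamespace false

open CategoryTheory AlgebraicGeometry Limits MonoidalCategory CartesianMonoidalCategory

namespace Summit.HodgeConjecture.HodgeConjecture.Theorems.HeckePrymWeilLine

open Literature.AlgebraicGeometry Literature.AlgebraicGeometry.Motives Literature.AlgebraicGeometry.HodgeTheory
open Literature.AlgebraicTopology.SingularHomology

/-- **Hodge type of an exterior product on `A × B`, typed with even dimensions**: for complex
abelian varieties `A`, `B` of dimensions `2n`, `2m` and classes `a ∈ H^{2n}(A(ℂ))` of type
`(p, q)`, `b ∈ H^{2m}(B(ℂ))` of type `(p', q')`, the exterior product `pr_A^* a ∪ pr_B^* b` is of type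
`(p + p', q + q')` on `A × B` with dimension parameter `2(n + m)` (Voisin I Thm. 11.38, the tree's
`isOfHodgeType_cupProduct_map_fst_map_snd_of_multiplicative_deRham` fed with de Rham's theorem
`exists_deRhamIsoFamily_holds`, the ambient dimension `2n + 2m` rewritten as `2(n + m)`).
[cite: VoisinHodgeI2002, §11.3.2 Thm. 11.38] -/
theorem uz_isOfHodgeType_cupProduct_map_fst_map_snd {A B : AbelianVariety ℂ} {n m : ℕ}
    (hA : A.dim = 2 * n) (hB : B.dim = 2 * m) {p q p' q' : ℕ} {a : complexBetti A.X (2 * n)}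
    {b : complexBetti B.X (2 * m)} (ha : IsOfHodgeType (2 * n) A.X (2 * n) p q a)
    (hb : IsOfHodgeType (2 * m) B.X (2 * m) p' q' b) :
    IsOfHodgeType (2 * (n + m)) (A.prod B).X (2 * (n + m)) (p + p') (q + q')
      (cupProduct (two_mul_add_two_mul n m)
        (complexBetti.map (AbelianVariety.fst A B).hom.hom.hom (2 * n) a)
        (complexBetti.map (AbelianVariety.snd A B).hom.hom.hom (2 * m) b)) := by
  have h := isOfHodgeType_cupProduct_map_fst_map_snd_of_multiplicative_deRham
    (fun E _ _ _ ↦ Literature.NumberTheory.Transcendental.exists_deRhamIsoFamily_holds E) A B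
    (2 * n) (2 * m) hA hB (2 * n) (2 * m) (2 * (n + m)) (two_mul_add_two_mul n m) p q p' q' a b
    ha hb
  rw [two_mul_add_two_mul n m] at h
  exact h

/-- **Stub `stub_unbalancedZero` (Deligne–Milne Prop. 4.4 on the product `A × B`)**: if the
complex abelian `2n`-fold `(A, φ)`, `φ ≫ φ = -p`, is NOT of balanced Weil type
(`dim (V₊ ∩ H^{1,0}(A)) ≠ n`) and the Weil surface `(B, ψ)`, `ψ ≫ ψ = -p`, carries a non-zero
`(1,1)` class in its strong Weil plane, then every class of Hodge type `(n+1, n+1)` in the strong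
Weil plane of `(A × B, φ × ψ)` vanishes: the two Weil lines of the product are spanned by the
exterior products `pr_A^* a± ∪ pr_B^* b±`, of types `(a+1, a'+1)` and `(a'+1, a+1)` with
`a + a' = 2n`, `a ≠ n`, both different from `(n+1, n+1)`, and the Hodge pieces are independent.
[cite: Deligne1982HodgeCycles, Prop. 4.4] [cite: vanGeemen1994HodgeAV, 4.9–4.10 and proof of Thm. 6.12] -/
theorem stub_unbalancedZero :
    ∀ p : ℕ, 0 < p → ∀ n : ℕ, 0 < n → ∀ (A : AbelianVariety ℂ) (φ : A ⟶ A) (B : AbelianVariety ℂ)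
      (ψ : B ⟶ B) (hA : A.dim = 2 * n), B.dim = 2 * 1 → φ ≫ φ = -(p • 𝟙 A) → ψ ≫ ψ = -(p • 𝟙 B) →
      (∃ b ∈ weilClassesOf B ψ 1 p, b ≠ 0 ∧ IsOfHodgeType (2 * 1) B.X (2 * 1) 1 1 b) →
      Module.finrank ℂ ↥(Module.End.eigenspace (complexBetti.map φ.hom.hom.hom 1).hom
          (Complex.I * (Real.sqrt p : ℂ)) ⊓ hodgeOneZero (Motives.isSmoothProjective_of_dim_eq' hA)) ≠ n →
      ∀ c ∈ weilClassesOf (A.prod B)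
          (AbelianVariety.prodLift (AbelianVariety.fst A B ≫ φ) (AbelianVariety.snd A B ≫ ψ)) (n + 1) p,
        IsOfHodgeType (2 * (n + 1)) (A.prod B).X (2 * (n + 1)) (n + 1) (n + 1) c → c = 0 := by
  intro p hp n hn A φ B ψ hA hB hφ hψ hbB hunb c hc hH
  obtain ⟨b, hbW, hb0, hbH⟩ := hbB
  -- `B` is balanced: its `K`-multiplicities are `(1, 1)`
  have hbal : Module.finrank ℂ ↥(Module.End.eigenspace (complexBetti.map ψ.hom.hom.hom 1).hom
        (Complex.I * (Real.sqrt p : ℂ)) ⊓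
      hodgeOneZero (Motives.isSmoothProjective_of_dim_eq' hB)) = 1 :=
    finrank_eq_of_mem_weilClassesOf one_pos hB hp hψ hbW hb0 hbH
  have hbal' : Module.finrank ℂ ↥(Module.End.eigenspace (complexBetti.map ψ.hom.hom.hom 1).hom
        (Complex.I * (Real.sqrt p : ℂ)) ⊓
      hodgeZeroOne (Motives.isSmoothProjective_of_dim_eq' hB)) = 1 := by
    have h := finrank_inf_hodgeOneZero_add_finrank_inf_hodgeZeroOne hB hp hψ
    rw [hbal] at h
    omega
  -- the `K`-multiplicities `(a, a')` of `A`, `a + a' = 2n`, `a ≠ n`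
  set a := Module.finrank ℂ ↥(Module.End.eigenspace (complexBetti.map φ.hom.hom.hom 1).hom
      (Complex.I * (Real.sqrt p : ℂ)) ⊓
    hodgeOneZero (Motives.isSmoothProjective_of_dim_eq' hA))
  set a' := Module.finrank ℂ ↥(Module.End.eigenspace (complexBetti.map φ.hom.hom.hom 1).hom
      (Complex.I * (Real.sqrt p : ℂ)) ⊓
    hodgeZeroOne (Motives.isSmoothProjective_of_dim_eq' hA))
  have haa' : a + a' = 2 * n := finrank_inf_hodgeOneZero_add_finrank_inf_hodgeZeroOne hA hp hφ
  -- the product `K`-structure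
  set Φ := AbelianVariety.prodLift (AbelianVariety.fst A B ≫ φ) (AbelianVariety.snd A B ≫ ψ)
  have hΦ : Φ ≫ Φ = -(p • 𝟙 (A.prod B)) := prodLift_comp_self_eq_neg_nsmul hφ hψ
  have h₁ : Φ ≫ AbelianVariety.fst A B = AbelianVariety.fst A B ≫ φ :=
    AbelianVariety.prodLift_fst _ _
  have h₂ : Φ ≫ AbelianVariety.snd A B = AbelianVariety.snd A B ≫ ψ :=
    AbelianVariety.prodLift_snd _ _
  have hAsp : IsSmoothProjective (2 * n) A.X := Motives.isSmoothProjective_of_dim_eq' hA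
  have hBsp : IsSmoothProjective (2 * 1) B.X := Motives.isSmoothProjective_of_dim_eq' hB
  have hPdim : (A.prod B).dim = 2 * (n + 1) := dim_prod_eq_two_mul hA hB
  have hPsp : IsSmoothProjective (2 * (n + 1)) (A.prod B).X :=
    Motives.isSmoothProjective_of_dim_eq' hPdim
  -- `H• = ⋀• H¹` and `b₁ = 2 dim` for `A`, `B`, `A × B`
  have hΛA := Motives.AbelianVariety.hasExteriorCohomologyH1_complexPoints A
  have hΛB := Motives.AbelianVariety.hasExteriorCohomologyH1_complexPoints B
  have hΛP := Motives.AbelianVariety.hasExteriorCohomologyH1_complexPoints (A.prod B)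
  have hbA : Module.finrank ℂ (complexBetti A.X 1) = 2 * (2 * n) := by
    rw [Motives.AbelianVariety.finrank_complexBetti_one, hA]
  have hbB' : Module.finrank ℂ (complexBetti B.X 1) = 2 * (2 * 1) := by
    rw [Motives.AbelianVariety.finrank_complexBetti_one, hB]
  have hbP : Module.finrank ℂ (complexBetti (A.prod B).X 1) = 2 * (2 * (n + 1)) := by
    rw [Motives.AbelianVariety.finrank_complexBetti_one, hPdim]
  -- non-zero generators of the four Weil lines of the factors
  obtain ⟨a₁, ha₁, ha₁0⟩ := sps_exists_ne_zero_of_finrank_eq_one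
    (finrank_weilClassesPlus_eq_one hΛA hbA hp hφ)
  obtain ⟨a₂, ha₂, ha₂0⟩ := sps_exists_ne_zero_of_finrank_eq_one
    (finrank_weilClassesMinus_eq_one hΛA hbA hp hφ)
  obtain ⟨b₁, hb₁, hb₁0⟩ := sps_exists_ne_zero_of_finrank_eq_one
    (finrank_weilClassesPlus_eq_one hΛB hbB' hp hψ)
  obtain ⟨b₂, hb₂, hb₂0⟩ := sps_exists_ne_zero_of_finrank_eq_one
    (finrank_weilClassesMinus_eq_one hΛB hbB' hp hψ)
  -- their Hodge types: `(a, a')`, `(a', a)`, `(1, 1)`, `(1, 1)`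
  have ta₁ : IsOfHodgeType (2 * n) A.X (2 * n) a a' a₁ :=
    isOfHodgeType_of_mem_weilClassesPlus hn hA hp hφ ha₁
  have ta₂ : IsOfHodgeType (2 * n) A.X (2 * n) a' a a₂ :=
    isOfHodgeType_of_mem_weilClassesMinus hn hA hp hφ ha₂
  have tb₁ : IsOfHodgeType (2 * 1) B.X (2 * 1) 1 1 b₁ := by
    have h := isOfHodgeType_of_mem_weilClassesPlus one_pos hB hp hψ hb₁
    rw [hbal, hbal'] at h
    exact h
  have tb₂ : IsOfHodgeType (2 * 1) B.X (2 * 1) 1 1 b₂ := by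
    have h := isOfHodgeType_of_mem_weilClassesMinus one_pos hB hp hψ hb₂
    rw [hbal, hbal'] at h
    exact h
  -- the exterior products `x± = pr_A^* a± ∪ pr_B^* b±`: non-zero members of `E±(A × B)`
  set x₁ := cupProduct (two_mul_add_two_mul n 1)
    (complexBetti.map (AbelianVariety.fst A B).hom.hom.hom (2 * n) a₁)
    (complexBetti.map (AbelianVariety.snd A B).hom.hom.hom (2 * 1) b₁)
  set x₂ := cupProduct (two_mul_add_two_mul n 1)
    (complexBetti.map (AbelianVariety.fst A B).hom.hom.hom (2 * n) a₂)
    (complexBetti.map (AbelianVariety.snd A B).hom.hom.hom (2 * 1) b₂)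
  have hx₁ : x₁ ∈ weilClassesPlus (A.prod B) Φ (n + 1) p :=
    cupProduct_map_fst_map_snd_mem_weilClassesPlus h₁ h₂ ha₁ hb₁
  have hx₂ : x₂ ∈ weilClassesMinus (A.prod B) Φ (n + 1) p :=
    cupProduct_map_fst_map_snd_mem_weilClassesMinus h₁ h₂ ha₂ hb₂
  have hx₁0 : x₁ ≠ 0 := sps_cupProduct_map_fst_map_snd_ne_zero_prod hAsp hBsp _ ha₁0 hb₁0
  have hx₂0 : x₂ ≠ 0 := sps_cupProduct_map_fst_map_snd_ne_zero_prod hAsp hBsp _ ha₂0 hb₂0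
  have tx₁ : IsOfHodgeType (2 * (n + 1)) (A.prod B).X (2 * (n + 1)) (a + 1) (a' + 1) x₁ :=
    uz_isOfHodgeType_cupProduct_map_fst_map_snd hA hB ta₁ tb₁
  have tx₂ : IsOfHodgeType (2 * (n + 1)) (A.prod B).X (2 * (n + 1)) (a' + 1) (a + 1) x₂ :=
    uz_isOfHodgeType_cupProduct_map_fst_map_snd hA hB ta₂ tb₂
  -- decompose `c = c₊ + c₋` along the two lines `E± (A × B) = ℂ · x±`
  obtain ⟨c₁, hc₁, c₂, hc₂, rfl⟩ := Submodule.mem_sup.1 hc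
  obtain ⟨t₁, rfl⟩ := Submodule.mem_span_singleton.1
    (weilClassesPlus_le_span_singleton hΛP hbP hp hΦ hx₁ hx₁0 hc₁)
  obtain ⟨t₂, rfl⟩ := Submodule.mem_span_singleton.1
    (weilClassesMinus_le_span_singleton hΛP hbP hp hΦ hx₂ hx₂0 hc₂)
  -- three types: `(n+1, n+1) ≠ (a+1, a'+1), (a'+1, a+1)`
  have hne₁ : (n + 1, n + 1) ≠ (a + 1, a' + 1) := by
    intro h
    have h' : n + 1 = a + 1 := (Prod.mk.inj h).1
    exact hunb (by omega)
  have hne₂ : (n + 1, n + 1) ≠ (a' + 1, a + 1) := by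
    intro h
    have h' : n + 1 = a' + 1 := (Prod.mk.inj h).1
    exact hunb (by omega)
  exact IsOfHodgeType.add_eq_zero_of_ne hPsp (tx₁.smul t₁) (tx₂.smul t₂) hH (by omega) (by omega)
    (by omega) hne₁ hne₂

end Summit.HodgeConjecture.HodgeConjecture.Theorems.HeckePrymWeilLine

end
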